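import Summits.CriticalPhenomena.CardyFormulaZ2.Theorems.CardyIKTransportIKMixedBoxCrossingDefectColourLawMixture
import Summits.CriticalPhenomena.CardyFormulaZ2.Theorems.CardyIKTransportIKMixedBoxCrossingDefectStubBridgeLaw

/-!
# Stub `stub_boxLawPivotAtom` of the line `defect-closure-exploration` (crux `IKMixedBoxCrossing`, stmt-CriticalPhenomena-5911)

Programme (R) helper (lead c3): the atoms of the finite free IK box law `boxLaw S Λ`, `Λ = [0, m] × [0, n]`, read on the
box through `freeBox`, in PRODUCT form — the coin weight `(1/2)^{(m+1)(n+1)}` times the mask mixture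
`Σ_{D ⊆ V} ρ^|D| (1−ρ)^{|V|−|D|} · (1/2)^{(m+1)(n+1)} · #{fillings s ⊆ Λ whose D-even pivot completion has colour pattern c}`,
`V = facesIn S Λ`, `ρ = maskDensity tIK`.  Proof: `{freeBox = (c, κ)} = evalCyl c ×ˢ evalCyl κ` (`preimage_freeBox`),
`boxLaw = colourLaw ⊗ coinMeasure ½` (`measureReal_prod_prod`, `coin_atom`), and the colour factor is the landed
`stub_colourLawMixture` at `E = evalCyl c`, pushed through `ENNReal.toReal` (`|Λ| = (m+1)(n+1)`, `card_cellRect`).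
-/

noncomputable section

namespace Summit.CriticalPhenomena.CardyFormulaZ2.Cruxes.IKMixedBoxCrossing.DefectClosureExploration

open scoped Classical ENNReal NNReal
open MeasureTheory Finset
open Literature.Probability.Percolation Literature.Probability.LatticeModels
open BridgeLawStub (site evalCyl preimage_freeBox coin_atom measurable_freeBox)

namespace BoxLawPivotAtomStub

/-- The cell rectangle at the origin has `k * l` cells. -/
theorem card_cellRect (k l : ℕ) : (cellRect 0 0 k l).card = k * l := by
  have hinj : Function.Injective fun p : ℤ × ℤ => (![p.1, p.2] : Site 2) := fun p q h =>
    Prod.ext (by simpa using congrFun h 0) (by simpa using congrFun h 1)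
  rw [cellRect, Finset.card_image_of_injective _ hinj, Finset.card_product]
  simp

/-- The cylinder of colourings with prescribed values on the cells of the box is measurable. -/
theorem measurableSet_evalCyl {m n : ℕ} (c : BridgeLawStub.Col m n) : MeasurableSet (evalCyl c) := by
  have h : evalCyl c = ⋂ q, (fun σ : Site 2 → Bool => σ (site q)) ⁻¹' {c q} := by
    ext σ; simp [evalCyl]
  rw [h]
  exact MeasurableSet.iInter fun q => measurable_pi_apply _ (measurableSet_singleton _)

/-- The mask weights `ρ^a (1 − ρ)^b` are nonnegative (`0 < ρ = 7 − 4√3 < 1/7`). -/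
theorem maskWeight_nonneg (a b : ℕ) : 0 ≤ maskDensity tIK ^ a * (1 - maskDensity tIK) ^ b := by
  rw [maskDensity_tIK]
  have h0 := ρIK_pos
  have h1 := seven_mul_ρIK_lt_one
  exact mul_nonneg (pow_nonneg h0.le _) (pow_nonneg (by linarith) _)

end BoxLawPivotAtomStub

open BoxLawPivotAtomStub in
/-- **Registered stub `stub_boxLawPivotAtom`** (programme (R) helper, line `defect-closure-exploration`): the atom of the box
law `boxLaw S Λ`, `Λ = cellRect 0 0 (m+1) (n+1)`, read through `freeBox`, at the box data `(c, κ)` (colour pattern `c`, coin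
pattern `κ`) is the coin weight `(1/2)^{(m+1)(n+1)}` times
`Σ_{D ⊆ facesIn S Λ} ρ^|D| (1−ρ)^{|V|−|D|} · (1/2)^{(m+1)(n+1)} · #{s ⊆ Λ | some D-even colouring agreeing with the filling s off
D + 1 has colour pattern c}`, `ρ = maskDensity tIK` — `preimage_freeBox`, `Measure.prod`, `coin_atom` and `stub_colourLawMixture`
at the cylinder `evalCyl c`. -/
theorem stub_boxLawPivotAtom : ∀ (S : Set ℤ) (m n : ℕ) (c κ : Fin (m + 1) × Fin (n + 1) → Bool),
    ((boxLaw S (cellRect 0 0 (m + 1) (n + 1))).map (freeBox (m + 1) (n + 1))).real {(c, κ)} =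
      (1 / 2 : ℝ) ^ ((m + 1) * (n + 1)) *
        ∑ D ∈ (facesIn S (cellRect 0 0 (m + 1) (n + 1))).powerset,
          maskDensity tIK ^ D.card * (1 - maskDensity tIK) ^ ((facesIn S (cellRect 0 0 (m + 1) (n + 1))).card - D.card) *
            ((1 / 2 : ℝ) ^ ((m + 1) * (n + 1)) *
              (((cellRect 0 0 (m + 1) (n + 1)).powerset.filter fun s => ∃ σ : Site 2 → Bool,
                  (∀ x : Site 2, x ∉ D.image (· + 1) → σ x = boxFill (cellRect 0 0 (m + 1) (n + 1)) (fun _ => false) s x) ∧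
                    (∀ g ∈ D, ¬ IsOddFace σ g) ∧
                      ∀ q : Fin (m + 1) × Fin (n + 1), σ ![((q.1 : ℕ) : ℤ), ((q.2 : ℕ) : ℤ)] = c q).card : ℝ)) := by
  intro S m n c κ
  haveI : IsProbabilityMeasure (colourLaw S (cellRect 0 0 (m + 1) (n + 1))) := by unfold colourLaw; infer_instance
  rw [map_measureReal_apply (measurable_freeBox _ _) (measurableSet_singleton _), preimage_freeBox, boxLaw,
    measureReal_prod_prod, coin_atom, mul_comm ((colourLaw S (cellRect 0 0 (m + 1) (n + 1))).real (evalCyl c)) _,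
    measureReal_def, stub_colourLawMixture S _ (evalCyl c) (measurableSet_evalCyl c), ENNReal.toReal_sum]
  · congr 1
    refine Finset.sum_congr rfl fun D _ => ?_
    rw [ENNReal.toReal_mul, ENNReal.toReal_mul, ENNReal.toReal_ofReal (maskWeight_nonneg _ _), ENNReal.toReal_inv,
      ENNReal.toReal_pow, ENNReal.toReal_ofNat, ENNReal.toReal_natCast, card_cellRect, one_div, inv_pow]
    congr 4
    exact Finset.filter_congr fun s _ =>
      ⟨fun ⟨σ, h1, h2, h3⟩ => ⟨σ, h2, h3, fun q => h1 q⟩, fun ⟨σ, h2, h3, h1⟩ => ⟨σ, fun q => h1 q, h2, h3⟩⟩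
  · intro D _
    exact ENNReal.mul_ne_top ENNReal.ofReal_ne_top
      (ENNReal.mul_ne_top (ENNReal.inv_ne_top.2 (pow_ne_zero _ two_ne_zero)) (ENNReal.natCast_ne_top _))

end Summit.CriticalPhenomena.CardyFormulaZ2.Cruxes.IKMixedBoxCrossing.DefectClosureExploration

end
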